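import Literature.Analysis.FunctionSpaces.GaussianSchwartz
import Mathlib.Analysis.Calculus.ContDiff.Bounds
import HarnessLib

/-!
# Gaussian envelopes for the joint space–time derivatives of the heat kernel

Analysis/UnboundedOperators support file (everything proved). The tree's `GaussianSchwartz.lean`
controls the **spatial** derivatives `Dⁿ_x W_t(x)` of the Gauss–Weierstrass kernel
`W_t(x) = (4πt)^{-d/2} e^{-‖x‖²/(4t)}` (`UnboundedOperators.heatKernel`) at fixed `t`, with the
parabolic scaling. Smoothing arguments in which the kernel carries the dependence on **both**
variables of a parabolic potential `(t, x) ↦ ∫ W_{t-s}(x - y) f(s, y)` (derivatives under the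
integral sign in `(t, x)` jointly, `SmoothParametricIntegralDominated.lean`) need bounds on the
joint iterated derivatives `D^N_{(t,x)} W` of `W̃(t, x) = W_t(x)` as a function on `(0, ∞) × E`.
This file proves them (joint smoothness itself, `W̃ ∈ C^∞((0, ∞) × E)`, is the tree's
`contDiffOn_uncurry_heatKernel` in `HeatKernelHeatEquation.lean` and is not restated here; the
bounds factor `W̃` as the product of `t ↦ (4πt)^{-d/2}` and `exp ∘ q`, `q(t, x) = -‖x‖²/(4t)`):

* `exists_norm_iteratedFDeriv_heatKernel_prod_le_pow_mul_exp` (**Faà di Bruno envelope**): for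
  every `N` and every compact time range `[t₀, t₁] ⊂ (0, ∞)` there are `C` and an exponent `M`
  with `‖D^N W̃(t, x)‖ ≤ C (max ‖x‖ 1)^M e^{-‖x‖²/(4t₁)}` for `t ∈ [t₀, t₁]` and all `x`
  (Mathlib's `norm_iteratedFDerivWithin_comp_le` for `exp ∘ q` and
  `norm_iteratedFDerivWithin_mul_le` for the products; the `t`-factors are bounded on the compact
  range by continuity of their iterated derivatives);
* `exists_norm_iteratedFDeriv_heatKernel_prod_le_exp` (**Gaussian envelope**):
  `‖D^N W̃(t, x)‖ ≤ C e^{-‖x‖²/(8t₁)}` on `[t₀, t₁] × E` (the polynomial weight is absorbed by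
  half of the Gaussian, `max_pow_mul_exp_neg_mul_sq_le`);
* `continuousOn_iteratedFDeriv_heatKernel_prod`: `(t, x) ↦ D^N W̃(t, x)` is continuous on
  `(0, ∞) × E` (measurability of the dominated integrands downstream).

## Mathlib / tree search

Mathlib: `norm_iteratedFDerivWithin_comp_le`, `norm_iteratedFDerivWithin_mul_le`,
`ContinuousLinearMap.iteratedFDerivWithin_comp_right`, `ContinuousLinearMap.iteratedFDeriv_comp_right`,
`iteratedFDerivWithin_of_isOpen`, `ContDiffOn.continuousOn_iteratedFDerivWithin`,
`IsCompact.exists_bound_of_continuousOn`, `ContDiffOn.rpow_const_of_ne`; nothing on joint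
derivatives of Gaussians (`Mathlib/Analysis/SpecialFunctions/Gaussian` has the Fourier side only).
Tree: `norm_iteratedFDeriv_norm_sq_le`, `norm_iteratedFDeriv_exp_const_mul`,
`max_pow_mul_exp_neg_mul_sq_le` (`GaussianSchwartz.lean`, `LittlewoodPaleyHeatProofs.lean`),
`contDiffOn_uncurry_heatKernel` (`HeatKernelHeatEquation.lean`, joint smoothness without bounds).

## References

* L. C. Evans, *Partial Differential Equations*, 2nd ed. (2010), §2.3.1 (the fundamental
  solution; "`Φ` is infinitely differentiable … with uniformly bounded derivatives of all orders on
  `ℝⁿ × [δ, ∞)`", proof of Thm. 1).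
* A. Friedman, *Partial Differential Equations of Parabolic Type* (1964), Ch. 1 §§4–6
  (Gaussian bounds for the derivatives of the fundamental solution).
-/

noncomputable section

open Set Filter Topology Function Metric
open scoped ContDiff Real

namespace Literature.Analysis.UnboundedOperators

variable {E : Type*} [NormedAddCommGroup E] [InnerProductSpace ℝ E]

/-! ### Derivatives of one-variable factors on a compact time range -/

section OneVariable

/-- **Iterated derivatives of a smooth function of `t > 0` are bounded on compact ranges**:
for `φ` smooth on `(0, ∞)`, `N`, and `[t₀, t₁] ⊂ (0, ∞)` there is `K ≥ 1` with
`‖Dⁱφ(t)‖ ≤ K` for all `i ≤ N`, `t ∈ [t₀, t₁]` (continuity of `iteratedFDerivWithin` on the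
open half-line, compactness). [folklore] -/
theorem exists_norm_iteratedFDerivWithin_Ioi_le {φ : ℝ → ℝ} (hφ : ContDiffOn ℝ ∞ φ (Ioi 0))
    (N : ℕ) {t₀ t₁ : ℝ} (ht₀ : 0 < t₀) :
    ∃ K : ℝ, 1 ≤ K ∧ ∀ i ≤ N, ∀ t ∈ Icc t₀ t₁, ‖iteratedFDerivWithin ℝ i φ (Ioi 0) t‖ ≤ K := by
  have hsub : Icc t₀ t₁ ⊆ Ioi 0 := fun t ht => ht₀.trans_le ht.1
  have hK : ∀ i : ℕ, ∃ K : ℝ, ∀ t ∈ Icc t₀ t₁, ‖iteratedFDerivWithin ℝ i φ (Ioi 0) t‖ ≤ K := by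
    intro i
    have hc : ContinuousOn (iteratedFDerivWithin ℝ i φ (Ioi 0)) (Icc t₀ t₁) :=
      (hφ.continuousOn_iteratedFDerivWithin (by exact_mod_cast le_top) (uniqueDiffOn_Ioi 0)).mono
        hsub
    exact isCompact_Icc.exists_bound_of_continuousOn hc
  choose K hK using hK
  refine ⟨max 1 (∑ i ∈ Finset.range (N + 1), |K i|), le_max_left _ _, fun i hi t ht => ?_⟩
  refine (hK i t ht).trans ((le_abs_self _).trans ((Finset.single_le_sum (f := fun i => |K i|)
    (fun j _ => abs_nonneg _) (Finset.mem_range.2 (Nat.lt_succ_of_le hi))).trans (le_max_right _ _)))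

omit [InnerProductSpace ℝ E] in
/-- The open half-space `(0, ∞) × E` is the preimage of `(0, ∞)` under the first projection.
[folklore] -/
theorem Ioi_prod_univ_eq_preimage_fst [NormedSpace ℝ E] :
    (Ioi (0 : ℝ) ×ˢ (univ : Set E)) = (ContinuousLinearMap.fst ℝ ℝ E) ⁻¹' Ioi 0 := by
  ext p
  simp

omit [InnerProductSpace ℝ E] in
/-- **Derivatives of a function of `t` alone, within the half-space**: for `φ` smooth on
`(0, ∞)`, `‖Dⁱ_{(t,x)} (φ ∘ fst)‖ ≤ ‖Dⁱφ(t)‖` at every point of `(0, ∞) × E`. [folklore] -/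
theorem norm_iteratedFDerivWithin_comp_fst_le [NormedSpace ℝ E] {φ : ℝ → ℝ}
    (hφ : ContDiffOn ℝ ∞ φ (Ioi 0)) (i : ℕ) {p : ℝ × E} (hp : p ∈ Ioi (0 : ℝ) ×ˢ (univ : Set E)) :
    ‖iteratedFDerivWithin ℝ i (fun q : ℝ × E => φ q.1) (Ioi 0 ×ˢ univ) p‖ ≤
      ‖iteratedFDerivWithin ℝ i φ (Ioi 0) p.1‖ := by
  have hp1 : 0 < p.1 := (mem_prod.1 hp).1
  have h := ContinuousLinearMap.iteratedFDerivWithin_comp_right (ContinuousLinearMap.fst ℝ ℝ E)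
    (f := φ) (s := Ioi 0) (x := p) (i := i) (n := ∞) hφ (uniqueDiffOn_Ioi 0)
    (by rw [← Ioi_prod_univ_eq_preimage_fst]; exact (isOpen_Ioi.prod isOpen_univ).uniqueDiffOn)
    hp1 (by exact_mod_cast le_top)
  rw [← Ioi_prod_univ_eq_preimage_fst] at h
  change iteratedFDerivWithin ℝ i (fun q : ℝ × E => φ q.1) (Ioi 0 ×ˢ univ) p = _ at h
  rw [h]
  refine (ContinuousMultilinearMap.norm_compContinuousLinearMap_le _ _).trans ?_
  have hfst : ∀ j : Fin i, ‖(ContinuousLinearMap.fst ℝ ℝ E)‖ ≤ 1 := fun _ =>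
    ContinuousLinearMap.norm_fst_le ℝ ℝ E
  calc ‖iteratedFDerivWithin ℝ i φ (Ioi 0) p.1‖ * ∏ _j : Fin i, ‖ContinuousLinearMap.fst ℝ ℝ E‖
      ≤ ‖iteratedFDerivWithin ℝ i φ (Ioi 0) p.1‖ * 1 := by
        refine mul_le_mul_of_nonneg_left ?_ (norm_nonneg _)
        exact Finset.prod_le_one (fun _ _ => norm_nonneg (ContinuousLinearMap.fst ℝ ℝ E))
          fun j _ => hfst j
    _ = _ := mul_one _

/-- **Derivatives of `(t, x) ↦ ‖x‖²` within the half-space**: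
`‖Dⁱ_{(t,x)} ‖x‖²‖ ≤ 4 (max ‖x‖ 1)² (2 max ‖x‖ 1)ⁱ` (the tree's `norm_iteratedFDeriv_norm_sq_le`
composed with the second projection). [folklore] -/
theorem norm_iteratedFDerivWithin_norm_sq_snd_le (i : ℕ) {p : ℝ × E}
    (hp : p ∈ Ioi (0 : ℝ) ×ˢ (univ : Set E)) :
    ‖iteratedFDerivWithin ℝ i (fun q : ℝ × E => ‖q.2‖ ^ 2) (Ioi 0 ×ˢ univ) p‖ ≤
      4 * (max ‖p.2‖ 1) ^ 2 * (2 * max ‖p.2‖ 1) ^ i := by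
  have hsm : ContDiff ℝ ∞ (fun x : E => ‖x‖ ^ 2) := contDiff_norm_sq ℝ
  have hcomp : ContDiff ℝ ∞ (fun q : ℝ × E => ‖q.2‖ ^ 2) := hsm.comp contDiff_snd
  rw [iteratedFDerivWithin_eq_iteratedFDeriv ((isOpen_Ioi.prod isOpen_univ).uniqueDiffOn)
    (hcomp.contDiffAt.of_le (by exact_mod_cast le_top)) hp]
  have h := ContinuousLinearMap.iteratedFDeriv_comp_right (ContinuousLinearMap.snd ℝ ℝ E)
    (f := fun x : E => ‖x‖ ^ 2) hsm p (i := i) (by exact_mod_cast le_top)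
  change iteratedFDeriv ℝ i (fun q : ℝ × E => ‖q.2‖ ^ 2) p = _ at h
  rw [h]
  have hm1 : 1 ≤ max ‖p.2‖ 1 := le_max_right _ _
  have hm0 : 0 ≤ max ‖p.2‖ 1 := zero_le_one.trans hm1
  refine (ContinuousMultilinearMap.norm_compContinuousLinearMap_le _ _).trans ?_
  have hprod : ∏ _j : Fin i, ‖ContinuousLinearMap.snd ℝ ℝ E‖ ≤ 1 :=
    Finset.prod_le_one (fun _ _ => norm_nonneg (ContinuousLinearMap.snd ℝ ℝ E))
      fun _ _ => ContinuousLinearMap.norm_snd_le ℝ ℝ E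
  have hD : ‖iteratedFDeriv ℝ i (fun x : E => ‖x‖ ^ 2) p.2‖ ≤ 4 * (max ‖p.2‖ 1) ^ 2 * (2 * max ‖p.2‖ 1) ^ i := by
    rcases Nat.eq_zero_or_pos i with hi | hi
    · subst hi
      rw [norm_iteratedFDeriv_zero, Real.norm_of_nonneg (sq_nonneg _), pow_zero, mul_one]
      nlinarith [le_max_left ‖p.2‖ 1, norm_nonneg p.2, hm1]
    · have h1 := FunctionSpaces.norm_iteratedFDeriv_norm_sq_le p.2 hi
      have hmax : max (2 * ‖p.2‖) 2 = 2 * max ‖p.2‖ 1 := by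
        rcases le_total ‖p.2‖ 1 with h2 | h2
        · rw [max_eq_right h2, max_eq_right (by linarith)]; ring
        · rw [max_eq_left h2, max_eq_left (by linarith)]
      rw [hmax] at h1
      refine h1.trans ?_
      have : 1 ≤ 4 * (max ‖p.2‖ 1) ^ 2 := by nlinarith
      exact le_mul_of_one_le_left (by positivity) this
  calc ‖iteratedFDeriv ℝ i (fun x : E => ‖x‖ ^ 2) p.2‖ * ∏ _j : Fin i, ‖ContinuousLinearMap.snd ℝ ℝ E‖
      ≤ (4 * (max ‖p.2‖ 1) ^ 2 * (2 * max ‖p.2‖ 1) ^ i) * 1 :=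
        mul_le_mul hD hprod (Finset.prod_nonneg fun _ _ => norm_nonneg (ContinuousLinearMap.snd ℝ ℝ E))
          (by positivity)
    _ = _ := mul_one _

end OneVariable

/-! ### The exponent `q(t, x) = -‖x‖²/(4t)` and the Faà di Bruno envelope -/

section Envelope

/-- `W_t(x) = c(t) e^{q(t, x)}` everywhere (junk values included). [folklore] -/
theorem heatKernel_eq_normalisation_mul_exp (p : ℝ × E) :
    heatKernel p.1 p.2 = (fun t : ℝ => (4 * π * t) ^ (-(Module.finrank ℝ E : ℝ) / 2)) p.1 * Real.exp ((fun p : ℝ × E => -(4 * p.1)⁻¹ * ‖p.2‖ ^ 2) p) := by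
  simp only [heatKernel]
  congr 2
  rw [div_eq_mul_inv, neg_mul, neg_mul, mul_comm]

/-- `t ↦ -(4t)⁻¹` is smooth on `(0, ∞)`. [folklore] -/
theorem contDiffOn_neg_inv_four_mul : ContDiffOn ℝ ∞ (fun t : ℝ => -(4 * t)⁻¹) (Ioi 0) := by
  refine (ContDiffOn.inv (by fun_prop) fun t ht => ?_).neg
  exact (mul_pos four_pos ht).ne'

/-- The normalisation `c` is smooth on `(0, ∞)`. [folklore] -/
theorem contDiffOn_heatNormalisation : ContDiffOn ℝ ∞ (fun t : ℝ => (4 * π * t) ^ (-(Module.finrank ℝ E : ℝ) / 2)) (Ioi 0) := by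
  refine ContDiffOn.rpow_const_of_ne (by fun_prop) fun t ht => ?_
  have ht' : 0 < t := mem_Ioi.1 ht
  have : 0 < 4 * π * t := by positivity
  exact this.ne'

/-- The exponent `q` is smooth on the half-space. [folklore] -/
theorem contDiffOn_heatExponent : ContDiffOn ℝ ∞ (fun p : ℝ × E => -(4 * p.1)⁻¹ * ‖p.2‖ ^ 2) (Ioi (0 : ℝ) ×ˢ (univ : Set E)) := by
  refine ContDiffOn.mul ?_ ?_
  · exact contDiffOn_neg_inv_four_mul.comp contDiffOn_fst fun p hp => (mem_prod.1 hp).1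
  · exact ((contDiff_norm_sq ℝ).comp contDiff_snd).contDiffOn

/-- **Derivatives of the exponent**: on `[t₀, t₁] × E`, for `i ≤ n`,
`‖Dⁱ q(t, x)‖ ≤ K 4^{n+1} (max ‖x‖ 1)^{n+2}` with the constant `K` of the factor `-(4t)⁻¹`
(Leibniz rule `norm_iteratedFDerivWithin_mul_le`). [folklore] -/
theorem norm_iteratedFDerivWithin_heatExponent_le {n : ℕ} {t₀ t₁ K : ℝ} (hK1 : 1 ≤ K)
    (hK : ∀ i ≤ n, ∀ t ∈ Icc t₀ t₁, ‖iteratedFDerivWithin ℝ i (fun t : ℝ => -(4 * t)⁻¹) (Ioi 0) t‖ ≤ K)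
    {i : ℕ} (hi : i ≤ n) {p : ℝ × E} (hp : p ∈ Ioi (0 : ℝ) ×ˢ (univ : Set E)) (hpt : p.1 ∈ Icc t₀ t₁) :
    ‖iteratedFDerivWithin ℝ i ((fun p : ℝ × E => -(4 * p.1)⁻¹ * ‖p.2‖ ^ 2)) (Ioi 0 ×ˢ univ) p‖ ≤
      K * 4 ^ (n + 1) * (max ‖p.2‖ 1) ^ (n + 2) := by
  have hU : UniqueDiffOn ℝ (Ioi (0 : ℝ) ×ˢ (univ : Set E)) := (isOpen_Ioi.prod isOpen_univ).uniqueDiffOn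
  have hf : ContDiffOn ℝ ∞ (fun q : ℝ × E => -(4 * q.1)⁻¹) (Ioi 0 ×ˢ univ) :=
    contDiffOn_neg_inv_four_mul.comp contDiffOn_fst fun p hp => (mem_prod.1 hp).1
  have hg : ContDiffOn ℝ ∞ (fun q : ℝ × E => ‖q.2‖ ^ 2) (Ioi 0 ×ˢ univ) :=
    ((contDiff_norm_sq ℝ).comp contDiff_snd).contDiffOn
  have hmul := norm_iteratedFDerivWithin_mul_le hf hg hU hp (n := i) (by exact_mod_cast le_top)
  have hm1 : 1 ≤ max ‖p.2‖ 1 := le_max_right _ _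
  have hm0 : 0 ≤ max ‖p.2‖ 1 := zero_le_one.trans hm1
  -- each term of the Leibniz sum
  have hterm : ∀ j ∈ Finset.range (i + 1),
      (i.choose j : ℝ) * ‖iteratedFDerivWithin ℝ j (fun q : ℝ × E => -(4 * q.1)⁻¹) (Ioi 0 ×ˢ univ) p‖ *
        ‖iteratedFDerivWithin ℝ (i - j) (fun q : ℝ × E => ‖q.2‖ ^ 2) (Ioi 0 ×ˢ univ) p‖ ≤
      (i.choose j : ℝ) * (K * (4 * (max ‖p.2‖ 1) ^ 2 * (2 * max ‖p.2‖ 1) ^ n)) := by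
    intro j hj
    have hji : j ≤ i := Nat.lt_succ_iff.1 (Finset.mem_range.1 hj)
    have h1 : ‖iteratedFDerivWithin ℝ j (fun q : ℝ × E => -(4 * q.1)⁻¹) (Ioi 0 ×ˢ univ) p‖ ≤ K :=
      (norm_iteratedFDerivWithin_comp_fst_le contDiffOn_neg_inv_four_mul j hp).trans
        (hK j (hji.trans hi) p.1 hpt)
    have h2 : ‖iteratedFDerivWithin ℝ (i - j) (fun q : ℝ × E => ‖q.2‖ ^ 2) (Ioi 0 ×ˢ univ) p‖ ≤
        4 * (max ‖p.2‖ 1) ^ 2 * (2 * max ‖p.2‖ 1) ^ n := by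
      refine (norm_iteratedFDerivWithin_norm_sq_snd_le (i - j) hp).trans ?_
      have h2le : (2 * max ‖p.2‖ 1) ^ (i - j) ≤ (2 * max ‖p.2‖ 1) ^ n :=
        pow_le_pow_right₀ (by linarith) ((Nat.sub_le i j).trans hi)
      exact mul_le_mul_of_nonneg_left h2le (by positivity)
    calc (i.choose j : ℝ) * ‖iteratedFDerivWithin ℝ j (fun q : ℝ × E => -(4 * q.1)⁻¹) (Ioi 0 ×ˢ univ) p‖ *
          ‖iteratedFDerivWithin ℝ (i - j) (fun q : ℝ × E => ‖q.2‖ ^ 2) (Ioi 0 ×ˢ univ) p‖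
        ≤ (i.choose j : ℝ) * K * (4 * (max ‖p.2‖ 1) ^ 2 * (2 * max ‖p.2‖ 1) ^ n) := by
          gcongr
      _ = _ := by ring
  have hsum : ∑ j ∈ Finset.range (i + 1), (i.choose j : ℝ) = 2 ^ i := by
    have := Nat.sum_range_choose i
    exact_mod_cast this
  calc ‖iteratedFDerivWithin ℝ i ((fun p : ℝ × E => -(4 * p.1)⁻¹ * ‖p.2‖ ^ 2)) (Ioi 0 ×ˢ univ) p‖
      ≤ ∑ j ∈ Finset.range (i + 1),
          (i.choose j : ℝ) * ‖iteratedFDerivWithin ℝ j (fun q : ℝ × E => -(4 * q.1)⁻¹) (Ioi 0 ×ˢ univ) p‖ *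
            ‖iteratedFDerivWithin ℝ (i - j) (fun q : ℝ × E => ‖q.2‖ ^ 2) (Ioi 0 ×ˢ univ) p‖ := hmul
    _ ≤ ∑ j ∈ Finset.range (i + 1), (i.choose j : ℝ) * (K * (4 * (max ‖p.2‖ 1) ^ 2 * (2 * max ‖p.2‖ 1) ^ n)) :=
        Finset.sum_le_sum hterm
    _ = 2 ^ i * (K * (4 * (max ‖p.2‖ 1) ^ 2 * (2 * max ‖p.2‖ 1) ^ n)) := by
        rw [← Finset.sum_mul, hsum]
    _ ≤ 2 ^ n * (K * (4 * (max ‖p.2‖ 1) ^ 2 * (2 * max ‖p.2‖ 1) ^ n)) := by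
        gcongr
        · norm_num
    _ = K * 4 ^ (n + 1) * (max ‖p.2‖ 1) ^ (n + 2) := by
        rw [mul_pow, pow_succ, pow_add]
        have : (4 : ℝ) ^ n = 2 ^ n * 2 ^ n := by rw [← mul_pow]; norm_num
        rw [this]
        ring

/-- **Faà di Bruno envelope for the joint derivatives of the heat kernel**: for every `N` and
every compact time range `[t₀, t₁] ⊂ (0, ∞)` there are `C ≥ 0` and `M : ℕ` such that
`‖D^N_{(t,x)} W(t, x)‖ ≤ C (max ‖x‖ 1)^M e^{-‖x‖²/(4t₁)}` for all `t ∈ [t₀, t₁]` and all `x`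
(here `D^N` is the joint `iteratedFDeriv` on `ℝ × E`, which on the open half-space agrees with
the derivative within it). Evans, §2.3.1; Friedman, Ch. 1 §6. [folklore] -/
theorem exists_norm_iteratedFDeriv_heatKernel_prod_le_pow_mul_exp (N : ℕ) {t₀ t₁ : ℝ}
    (ht₀ : 0 < t₀) (h01 : t₀ ≤ t₁) :
    ∃ C : ℝ, 0 ≤ C ∧ ∃ M : ℕ, ∀ t ∈ Icc t₀ t₁, ∀ x : E,
      ‖iteratedFDeriv ℝ N (fun p : ℝ × E => heatKernel p.1 p.2) (t, x)‖ ≤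
        C * (max ‖x‖ 1) ^ M * Real.exp (-‖x‖ ^ 2 / (4 * t₁)) := by
  have ht₁ : 0 < t₁ := ht₀.trans_le h01
  have hU : UniqueDiffOn ℝ (Ioi (0 : ℝ) ×ˢ (univ : Set E)) := (isOpen_Ioi.prod isOpen_univ).uniqueDiffOn
  have hopen : IsOpen (Ioi (0 : ℝ) ×ˢ (univ : Set E)) := isOpen_Ioi.prod isOpen_univ
  -- constants of the one-variable factors
  obtain ⟨K, hK1, hK⟩ := exists_norm_iteratedFDerivWithin_Ioi_le contDiffOn_neg_inv_four_mul N ht₀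
    (t₁ := t₁)
  obtain ⟨Kc, hKc1, hKc⟩ := exists_norm_iteratedFDerivWithin_Ioi_le
    (contDiffOn_heatNormalisation (E := E)) N ht₀ (t₁ := t₁)
  -- the envelope
  refine ⟨2 ^ N * Kc * N.factorial * (K * 4 ^ (N + 1)) ^ N, by positivity, (N + 2) * N, fun t ht x => ?_⟩
  set p : ℝ × E := (t, x) with hp_def
  have hp : p ∈ Ioi (0 : ℝ) ×ˢ (univ : Set E) := mk_mem_prod (ht₀.trans_le ht.1) (mem_univ x)
  have hm1 : 1 ≤ max ‖x‖ 1 := le_max_right _ _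
  have hm0 : 0 ≤ max ‖x‖ 1 := zero_le_one.trans hm1
  -- `D := K 4^{N+1} (max ‖x‖ 1)^{N+2} ≥ 1` dominates all derivatives of `q` of order `≤ N`
  set D : ℝ := K * 4 ^ (N + 1) * (max ‖x‖ 1) ^ (N + 2) with hD
  have hD1 : 1 ≤ D := by
    rw [hD]
    have h4 : (1 : ℝ) ≤ 4 ^ (N + 1) := one_le_pow₀ (by norm_num)
    have hm : (1 : ℝ) ≤ (max ‖x‖ 1) ^ (N + 2) := one_le_pow₀ hm1
    nlinarith [mul_le_mul hK1 h4 zero_le_one (zero_le_one.trans hK1)]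
  have hqD : ∀ i, 1 ≤ i → i ≤ N →
      ‖iteratedFDerivWithin ℝ i ((fun p : ℝ × E => -(4 * p.1)⁻¹ * ‖p.2‖ ^ 2)) (Ioi 0 ×ˢ univ) p‖ ≤ D ^ i := by
    intro i hi1 hiN
    have h := norm_iteratedFDerivWithin_heatExponent_le (E := E) hK1 hK hiN hp ht
    refine h.trans ?_
    calc K * 4 ^ (N + 1) * (max ‖p.2‖ 1) ^ (N + 2) = D := by rw [hD]
      _ = D ^ 1 := (pow_one D).symm
      _ ≤ D ^ i := pow_le_pow_right₀ hD1 hi1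
  -- Faà di Bruno for `exp ∘ q`
  have hexpC : ∀ i ≤ N, ‖iteratedFDerivWithin ℝ i Real.exp univ ((fun p : ℝ × E => -(4 * p.1)⁻¹ * ‖p.2‖ ^ 2) p)‖ ≤
      Real.exp ((fun p : ℝ × E => -(4 * p.1)⁻¹ * ‖p.2‖ ^ 2) p) := by
    intro i _
    rw [iteratedFDerivWithin_univ]
    have h := FunctionSpaces.norm_iteratedFDeriv_exp_const_mul 1 i ((fun p : ℝ × E => -(4 * p.1)⁻¹ * ‖p.2‖ ^ 2) p)
    simp only [one_mul, abs_one, one_pow] at h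
    exact h.le
  have hFdB := norm_iteratedFDerivWithin_comp_le (g := Real.exp) (f := (fun p : ℝ × E => -(4 * p.1)⁻¹ * ‖p.2‖ ^ 2))
    (n := N) (N := ∞) (s := Ioi 0 ×ˢ univ) (t := univ) (x := p)
    Real.contDiff_exp.contDiffOn contDiffOn_heatExponent (by exact_mod_cast le_top) uniqueDiffOn_univ
    hU (mapsTo_univ _ _) hp hexpC hqD
  -- Leibniz for `c(t) · (exp ∘ q)`
  have hf : ContDiffOn ℝ ∞ (fun q : ℝ × E => (fun t : ℝ => (4 * π * t) ^ (-(Module.finrank ℝ E : ℝ) / 2)) q.1) (Ioi 0 ×ˢ univ) :=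
    contDiffOn_heatNormalisation.comp contDiffOn_fst fun p hp => (mem_prod.1 hp).1
  have hg : ContDiffOn ℝ ∞ (Real.exp ∘ (fun p : ℝ × E => -(4 * p.1)⁻¹ * ‖p.2‖ ^ 2)) (Ioi 0 ×ˢ univ) :=
    Real.contDiff_exp.comp_contDiffOn contDiffOn_heatExponent
  have hmul := norm_iteratedFDerivWithin_mul_le hf hg hU hp (n := N) (by exact_mod_cast le_top)
  -- lower-order Faà di Bruno bounds, uniformly `≤ N! e^q D^N`
  have hgj : ∀ j ≤ N, ‖iteratedFDerivWithin ℝ j (Real.exp ∘ (fun p : ℝ × E => -(4 * p.1)⁻¹ * ‖p.2‖ ^ 2)) (Ioi 0 ×ˢ univ) p‖ ≤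
      N.factorial * Real.exp ((fun p : ℝ × E => -(4 * p.1)⁻¹ * ‖p.2‖ ^ 2) p) * D ^ N := by
    intro j hj
    have hj' := norm_iteratedFDerivWithin_comp_le (g := Real.exp) (f := (fun p : ℝ × E => -(4 * p.1)⁻¹ * ‖p.2‖ ^ 2))
      (n := j) (N := ∞) (s := Ioi 0 ×ˢ univ) (t := univ) (x := p)
      Real.contDiff_exp.contDiffOn contDiffOn_heatExponent (by exact_mod_cast le_top) uniqueDiffOn_univ
      hU (mapsTo_univ _ _) hp (fun i hi => hexpC i (hi.trans hj)) (fun i hi1 hij => hqD i hi1 (hij.trans hj))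
    refine hj'.trans ?_
    have hfac : (j.factorial : ℝ) ≤ N.factorial := by exact_mod_cast Nat.factorial_le hj
    have hpow : D ^ j ≤ D ^ N := pow_le_pow_right₀ hD1 hj
    have he : 0 ≤ Real.exp ((fun p : ℝ × E => -(4 * p.1)⁻¹ * ‖p.2‖ ^ 2) p) := (Real.exp_pos _).le
    gcongr
  -- identify the kernel with `c · exp ∘ q` on the open set and pass to `iteratedFDeriv`
  have heq : (fun p : ℝ × E => heatKernel p.1 p.2) = fun q : ℝ × E =>
      (fun t : ℝ => (4 * π * t) ^ (-(Module.finrank ℝ E : ℝ) / 2)) q.1 * (Real.exp ∘ (fun p : ℝ × E => -(4 * p.1)⁻¹ * ‖p.2‖ ^ 2)) q :=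
    funext fun q => heatKernel_eq_normalisation_mul_exp q
  rw [← iteratedFDerivWithin_of_isOpen N hopen hp, heq]
  -- the sum
  have hterm : ∀ j ∈ Finset.range (N + 1),
      (N.choose j : ℝ) * ‖iteratedFDerivWithin ℝ j (fun q : ℝ × E => (fun t : ℝ => (4 * π * t) ^ (-(Module.finrank ℝ E : ℝ) / 2)) q.1) (Ioi 0 ×ˢ univ) p‖ *
        ‖iteratedFDerivWithin ℝ (N - j) (Real.exp ∘ (fun p : ℝ × E => -(4 * p.1)⁻¹ * ‖p.2‖ ^ 2)) (Ioi 0 ×ˢ univ) p‖ ≤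
      (N.choose j : ℝ) * (Kc * (N.factorial * Real.exp ((fun p : ℝ × E => -(4 * p.1)⁻¹ * ‖p.2‖ ^ 2) p) * D ^ N)) := by
    intro j hj
    have hjN : j ≤ N := Nat.lt_succ_iff.1 (Finset.mem_range.1 hj)
    have h1 : ‖iteratedFDerivWithin ℝ j (fun q : ℝ × E => (fun t : ℝ => (4 * π * t) ^ (-(Module.finrank ℝ E : ℝ) / 2)) q.1) (Ioi 0 ×ˢ univ) p‖ ≤ Kc :=
      (norm_iteratedFDerivWithin_comp_fst_le contDiffOn_heatNormalisation j hp).trans (hKc j hjN t ht)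
    have h2 := hgj (N - j) (Nat.sub_le N j)
    have h0 : 0 ≤ N.factorial * Real.exp ((fun p : ℝ × E => -(4 * p.1)⁻¹ * ‖p.2‖ ^ 2) p) * D ^ N := by
      have := (Real.exp_pos ((fun p : ℝ × E => -(4 * p.1)⁻¹ * ‖p.2‖ ^ 2) p)).le
      positivity
    calc (N.choose j : ℝ) * ‖iteratedFDerivWithin ℝ j (fun q : ℝ × E => (fun t : ℝ => (4 * π * t) ^ (-(Module.finrank ℝ E : ℝ) / 2)) q.1) (Ioi 0 ×ˢ univ) p‖ *
          ‖iteratedFDerivWithin ℝ (N - j) (Real.exp ∘ (fun p : ℝ × E => -(4 * p.1)⁻¹ * ‖p.2‖ ^ 2)) (Ioi 0 ×ˢ univ) p‖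
        ≤ (N.choose j : ℝ) * Kc * (N.factorial * Real.exp ((fun p : ℝ × E => -(4 * p.1)⁻¹ * ‖p.2‖ ^ 2) p) * D ^ N) := by
          gcongr
      _ = _ := by ring
  have hsum : ∑ j ∈ Finset.range (N + 1), (N.choose j : ℝ) = 2 ^ N := by
    exact_mod_cast Nat.sum_range_choose N
  have hexp_le : Real.exp ((fun p : ℝ × E => -(4 * p.1)⁻¹ * ‖p.2‖ ^ 2) p) ≤ Real.exp (-‖x‖ ^ 2 / (4 * t₁)) := by
    rw [Real.exp_le_exp]
    change -(4 * t)⁻¹ * ‖x‖ ^ 2 ≤ -‖x‖ ^ 2 / (4 * t₁)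
    rw [neg_mul, neg_div, neg_le_neg_iff, div_eq_mul_inv, mul_comm]
    refine mul_le_mul_of_nonneg_right ?_ (sq_nonneg _)
    have ht' : 0 < t := ht₀.trans_le ht.1
    exact inv_anti₀ (by positivity) (by linarith [ht.2])
  calc ‖iteratedFDerivWithin ℝ N (fun q : ℝ × E => (fun t : ℝ => (4 * π * t) ^ (-(Module.finrank ℝ E : ℝ) / 2)) q.1 *
          (Real.exp ∘ (fun p : ℝ × E => -(4 * p.1)⁻¹ * ‖p.2‖ ^ 2)) q) (Ioi 0 ×ˢ univ) p‖
      ≤ ∑ j ∈ Finset.range (N + 1),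
          (N.choose j : ℝ) * ‖iteratedFDerivWithin ℝ j (fun q : ℝ × E => (fun t : ℝ => (4 * π * t) ^ (-(Module.finrank ℝ E : ℝ) / 2)) q.1) (Ioi 0 ×ˢ univ) p‖ *
            ‖iteratedFDerivWithin ℝ (N - j) (Real.exp ∘ (fun p : ℝ × E => -(4 * p.1)⁻¹ * ‖p.2‖ ^ 2)) (Ioi 0 ×ˢ univ) p‖ := hmul
    _ ≤ ∑ j ∈ Finset.range (N + 1), (N.choose j : ℝ) * (Kc * (N.factorial * Real.exp ((fun p : ℝ × E => -(4 * p.1)⁻¹ * ‖p.2‖ ^ 2) p) * D ^ N)) :=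
        Finset.sum_le_sum hterm
    _ = 2 ^ N * (Kc * (N.factorial * Real.exp ((fun p : ℝ × E => -(4 * p.1)⁻¹ * ‖p.2‖ ^ 2) p) * D ^ N)) := by
        rw [← Finset.sum_mul, hsum]
    _ = 2 ^ N * Kc * N.factorial * (K * 4 ^ (N + 1)) ^ N * (max ‖x‖ 1) ^ ((N + 2) * N) *
          Real.exp ((fun p : ℝ × E => -(4 * p.1)⁻¹ * ‖p.2‖ ^ 2) p) := by
        rw [hD, mul_pow, ← pow_mul]
        ring
    _ ≤ 2 ^ N * Kc * N.factorial * (K * 4 ^ (N + 1)) ^ N * (max ‖x‖ 1) ^ ((N + 2) * N) *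
          Real.exp (-‖x‖ ^ 2 / (4 * t₁)) :=
        mul_le_mul_of_nonneg_left hexp_le (by positivity)

/-- **Gaussian envelope for the joint derivatives of the heat kernel**: for every `N` and every
compact time range `[t₀, t₁] ⊂ (0, ∞)` there is `C ≥ 0` with
`‖D^N_{(t,x)} W(t, x)‖ ≤ C e^{-‖x‖²/(8t₁)}` for `t ∈ [t₀, t₁]` and all `x` (the polynomial weight of
the Faà di Bruno envelope is absorbed by half of the Gaussian). Evans, §2.3.1 (proof of Thm. 1:
"uniformly bounded derivatives of all orders on `ℝⁿ × [δ, ∞)`"); Friedman, Ch. 1 §6. [folklore] -/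
theorem exists_norm_iteratedFDeriv_heatKernel_prod_le_exp (N : ℕ) {t₀ t₁ : ℝ}
    (ht₀ : 0 < t₀) (h01 : t₀ ≤ t₁) :
    ∃ C : ℝ, 0 ≤ C ∧ ∀ t ∈ Icc t₀ t₁, ∀ x : E,
      ‖iteratedFDeriv ℝ N (fun p : ℝ × E => heatKernel p.1 p.2) (t, x)‖ ≤
        C * Real.exp (-‖x‖ ^ 2 / (8 * t₁)) := by
  have ht₁ : 0 < t₁ := ht₀.trans_le h01
  obtain ⟨C, hC, M, hb⟩ := exists_norm_iteratedFDeriv_heatKernel_prod_le_pow_mul_exp (E := E) N ht₀ h01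
  have ha : 0 < 1 / (8 * t₁) := by positivity
  refine ⟨C * (1 + M.factorial / (1 / (8 * t₁)) ^ M), by positivity, fun t ht x => ?_⟩
  have h := hb t ht x
  have hsplit : Real.exp (-‖x‖ ^ 2 / (4 * t₁)) =
      Real.exp (-(1 / (8 * t₁)) * ‖x‖ ^ 2) * Real.exp (-‖x‖ ^ 2 / (8 * t₁)) := by
    rw [← Real.exp_add]
    congr 1
    field_simp
    ring
  have hM := FunctionSpaces.max_pow_mul_exp_neg_mul_sq_le ha M ‖x‖
  calc ‖iteratedFDeriv ℝ N (fun p : ℝ × E => heatKernel p.1 p.2) (t, x)‖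
      ≤ C * (max ‖x‖ 1) ^ M * Real.exp (-‖x‖ ^ 2 / (4 * t₁)) := h
    _ = C * ((max ‖x‖ 1) ^ M * Real.exp (-(1 / (8 * t₁)) * ‖x‖ ^ 2)) * Real.exp (-‖x‖ ^ 2 / (8 * t₁)) := by
        rw [hsplit]; ring
    _ ≤ C * (1 + M.factorial / (1 / (8 * t₁)) ^ M) * Real.exp (-‖x‖ ^ 2 / (8 * t₁)) := by
        gcongr

/-- **Continuity of the joint derivatives** of the heat kernel on the half-space (from the joint
smoothness `contDiffOn_uncurry_heatKernel`). [folklore] -/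
theorem continuousOn_iteratedFDeriv_heatKernel_prod (N : ℕ) :
    ContinuousOn (fun p : ℝ × E => iteratedFDeriv ℝ N (fun q : ℝ × E => heatKernel q.1 q.2) p)
      (Ioi 0 ×ˢ univ) := by
  have hopen : IsOpen (Ioi (0 : ℝ) ×ˢ (univ : Set E)) := isOpen_Ioi.prod isOpen_univ
  have h := contDiffOn_uncurry_heatKernel (E := E) (m := ∞) |>.continuousOn_iteratedFDerivWithin
    (m := N) (by exact_mod_cast le_top) hopen.uniqueDiffOn
  exact h.congr fun p hp => (iteratedFDerivWithin_of_isOpen N hopen hp).symm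

end Envelope

end Literature.Analysis.UnboundedOperators

end
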